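import Summits.BirchSwinnertonDyer.BirchSwinnertonDyer.Theorems.PrintX10bReadoutLocalClausesKSAnyClassNumber
import Summits.BirchSwinnertonDyer.BirchSwinnertonDyer.Theorems.PrintX10bStubReadoutSelmerKS
import HarnessLib

/-!
# The two readout KS-clauses (B4) `readoutSelmerKS` and (B5) `readoutIndexKS` AT EVERY CLASS NUMBER (finding «hhK-IDLE», LEAD g11; K2b)

Cell `run/shared/lean/pub/bsd-print-x9/`, seat bsd-line-x10b-p1-w8 g9 («MINE K2» 02:47Z under LEAD g11's K-plan). Summits-side,
THEOREMS ONLY (no abbrev/def, no named fact, no instance, no `sorry`), ROUTE-INDEPENDENT (no `Theses` import),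
`--supports stmt-BirchSwinnertonDyer-23055` (helper). HONEST FRAMING: nothing is closed; «beyond-print theorem»: no. BSD is not proved
by any of this; no summit statement is proved by this seat.

WHAT. The KS-letters `Stmt.readoutSelmerKS` / `Stmt.readoutIndexKS` (`PrintX10bControlGlueOfClausesKS`, LEAD g10) with EXACTLY the
three idle binders `¬ W.HasCM`, `MastellaZerman2026.HasPadicScalarImage W p`, `p ∣ NumberField.classNumber K` deleted (leading
`Stmt.kummerStrictOnFrames`, `hirr`, `hirrK`, `hHp` kept), stated as theorems and proved by the landed proofs verbatim:
* §1 `readoutSelmerKS_anyClassNumber` — proof = `stub_readoutSelmerKS` (x10b-p2 LEAD g7 / LEAD g10, p684243-lineage): `Γ_K`-stability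
  of the readout, complex places discarded, the `v`-adapted representative read through
  `eisensteinTowerReadout_of_mem_localKerOver_of_mem_eisensteinSelmerStructure_ks` (imported, not restated).
* §2 `readoutIndexKS_anyClassNumber` — proof = `readoutIndexKS_of_localClauses` (x10b-p1-w2 g11 / LEAD g10) fed with the three
  any-class-number place-wise clauses of K2a (`readoutLocal{Off,IndexP,IndexBad}KS_anyClassNumber`).
Companion K2c (`PrintX10bControlGlueKSAnyClassNumber`) assembles `controlGlueKS_anyClassNumber` from these two.

References: [Howard2004HeegnerKolyvagin] Def. 2.1.10, Lemma 2.2.7 / Prop. 2.2.8 (second map), proof of Thm. 2.2.10 (𝔮 = T^m + p);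
[GreenbergLNM1716] Prop. 2.4, §3 Lemma 3.3, §4 pp. 98, 104; [GreenbergVatsal2000] §2 p. 17; [MazurRubin2004] Lemma 3.5.3.
-/

set_option linter.dupNamespace false
set_option autoImplicit false

noncomputable section

open scoped Classical Pointwise ContRepresentation TensorProduct NumberField

open Function NumberField IsDedekindDomain Field
open Literature Literature.NumberTheory.EllipticCurves WeierstrassCurve
open Literature.NumberTheory.GaloisCohomology Literature.NumberTheory.GaloisCohomology.Howard2004
open Literature.NumberTheory.GaloisRepresentations Literature.NumberTheory.GaloisRepresentations.DiscreteGaloisModule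
open Literature.NumberTheory.EllipticCurves.GreenbergSelmer
open Summit.BirchSwinnertonDyer.BirchSwinnertonDyer.Theorems
open Literature.NumberTheory.EllipticCurves.ZpExtension (EisensteinLevel)

namespace Summit.BirchSwinnertonDyer.BirchSwinnertonDyer.Theorems.HeegnerMuPartControlGlue

/-! ## §1 (B4) -/

set_option maxHeartbeats 1600000 in
set_option synthInstance.maxHeartbeats 80000 in
/-- **(B4) at every class number** — the KS-letter `Stmt.readoutSelmerKS` with the three idle binders (`¬ CM`, scalar image,
`p ∣ h_K`) deleted: for `m ≫ 0` (`m₁ := 0`) and every admissible Eisenstein datum, the readout of Howard's propagated Selmer group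
`H¹_{F_𝔮}(K, A_𝔮)` lies in `Sel_{p^∞}(E/K_∞)`. Proof verbatim `stub_readoutSelmerKS`.
[cite: Howard2004HeegnerKolyvagin, Lemma 2.2.7 / Prop. 2.2.8 and proof of Thm. 2.2.10 (𝔮 = T^m + p)]
[cite: GreenbergLNM1716, §2 Prop. 2.4 and §3 p. 87] [cite: GreenbergVatsal2000, §2 p. 17] -/
theorem readoutSelmerKS_anyClassNumber :
    Stmt.kummerStrictOnFrames →
    ∀ (N : ℕ) [NeZero N] (W : WeierstrassCurve ℚ) [W.IsGloballyMinimal] (K : Type) [Field K] [NumberField K]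
      (p : ℕ) [Fact p.Prime] (κ : ZpExtension K p) (γ : Field.absoluteGaloisGroup K)
      (jbar : AlgebraicClosure K →+* ℂ) (hyp : CastellaGrossiLeeSkinner2022.Thm413Hypotheses N W K p κ γ),
      W.HasIrreducibleModPGaloisRep p → (W.baseChange K).HasIrreducibleModPGaloisRep p →
      SatisfiesHeegnerHypothesis p K →
      ∃ m₁ : ℕ, ∀ (m : ℕ) (hm : 1 ≤ m), m₁ ≤ m →
        haveI := hyp.isElliptic
        letI := IwasawaAlgebra.isDomain_quotient_X_pow_add_C p hm
        letI := IwasawaAlgebra.isDiscreteValuationRing_quotient_X_pow_add_C p hm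
        haveI := IwasawaAlgebra.EisensteinCoeff.isLocalRing_succ p hm
        letI := IwasawaAlgebra.EisensteinCoeff.algebraOfSpecSucc p m
        haveI := W.isScalarTower_algebraOfSpecSucc (K := K) (p := p) (m := m)
        letI := W.residueModuleSucc (K := K) (p := p) hm
        ∀ (S : Finset (IsDedekindDomain.HeightOneSpectrum (NumberField.RingOfIntegers K)))
          (hpS : ∀ v, ((p : ℕ) : NumberField.RingOfIntegers K) ∈ v.asIdeal → v ∈ S)
          (hbad : ∀ v, v ∉ S → ((p : ℕ) : NumberField.RingOfIntegers K) ∉ v.asIdeal →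
            (W.baseChange K).HasGoodReductionAt v)
          (_hSN : ∀ v ∈ S, ((p : ℕ) : NumberField.RingOfIntegers K) ∈ v.asIdeal ∨
            ((N : ℕ) : NumberField.RingOfIntegers K) ∈ v.asIdeal)
          (_hSσ : ∀ (σ : K ≃ₐ[ℚ] K) (v : IsDedekindDomain.HeightOneSpectrum (NumberField.RingOfIntegers K)),
            σ • v ∈ S → v ∈ S)
          (L : Set (IsDedekindDomain.HeightOneSpectrum (NumberField.RingOfIntegers K)))
          (hL : L ⊆ (W.eisensteinTower (κ.unitTwist (-1)) hm).degreeTwoPrimes p)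
          (hLS : ∀ v ∈ L, v ∉ S) (jbar' : AlgebraicClosure K →+* ℂ) (cd : ConjugationDatum K)
          (Dd : ∀ k, DualityDatum p cd ((W.eisensteinTower (κ.unitTwist (-1)) hm).ρ k)
            (IwasawaAlgebra.EisensteinCoeff p m (k + 1)))
          (fs : ∀ (k : ℕ) (n : Finset (IsDedekindDomain.HeightOneSpectrum (NumberField.RingOfIntegers K)))
            (v : IsDedekindDomain.HeightOneSpectrum (NumberField.RingOfIntegers K)),
            galoisCohomology ((W.eisensteinLevelQuot (κ.unitTwist (-1)) hm k n).toLocal (Sum.inr v)) 1 →+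
              SingularQuotient (GaloisRep.toLocal v (W.eisensteinLevelQuot (κ.unitTwist (-1)) hm k n)) ⊗[ℤ]
                Gell v)
          (hy : (W.eisensteinDVRSetting (κ.unitTwist (-1)) hm S hpS hbad L hL hLS jbar' cd Dd fs).SatisfiesH)
          (hπ : (W.eisensteinDVRSetting (κ.unitTwist (-1)) hm S hpS hbad L hL hLS jbar' cd Dd fs).π ∈ IsLocalRing.maximalIdeal (IwasawaAlgebra p ⧸ Ideal.span {(PowerSeries.X ^ m + PowerSeries.C (p : ℤ_[p]) : IwasawaAlgebra p)}))
          (he : ∀ k, (W.eisensteinDVRSetting (κ.unitTwist (-1)) hm S hpS hbad L hL hLS jbar' cd Dd fs).e k ≤ (W.eisensteinDVRSetting (κ.unitTwist (-1)) hm S hpS hbad L hL hLS jbar' cd Dd fs).e (k + 1))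
          (hπX : (W.eisensteinDVRSetting (κ.unitTwist (-1)) hm S hpS hbad L hL hLS jbar' cd Dd fs).π =
            Ideal.Quotient.mk (Ideal.span {(PowerSeries.X ^ m + PowerSeries.C (p : ℤ_[p]) : IwasawaAlgebra p)}) PowerSeries.X)
          (hek : ∀ k, (W.eisensteinDVRSetting (κ.unitTwist (-1)) hm S hpS hbad L hL hLS jbar' cd Dd fs).e (k + 1) - (W.eisensteinDVRSetting (κ.unitTwist (-1)) hm S hpS hbad L hL hLS jbar' cd Dd fs).e k = m),
          ∀ a ∈ ((W.eisensteinDVRSetting (κ.unitTwist (-1)) hm S hpS hbad L hL hLS jbar' cd Dd fs).T.selmerA (W.eisensteinDVRSetting (κ.unitTwist (-1)) hm S hpS hbad L hL hLS jbar' cd Dd fs).π (W.eisensteinDVRSetting (κ.unitTwist (-1)) hm S hpS hbad L hL hLS jbar' cd Dd fs).e hy.killed hy.ker_red hπ he (fun k ↦ ((W.eisensteinDVRSetting (κ.unitTwist (-1)) hm S hpS hbad L hL hLS jbar' cd Dd fs).t k).cond)),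
            (W.eisensteinTowerReadout κ hm (W.eisensteinDVRSetting (κ.unitTwist (-1)) hm S hpS hbad L hL hLS jbar' cd Dd fs).π (W.eisensteinDVRSetting (κ.unitTwist (-1)) hm S hpS hbad L hL hLS jbar' cd Dd fs).e hy.killed hy.ker_red hπ he hπX hek) a ∈ (W.baseChange K).selmerInfty κ := by
  intro hKS N _ W _ K _ _ p _ κ γ jbar hyp _hirr _hirrK hHp
  haveI := hyp.isElliptic
  refine ⟨0, fun m hm _ ↦ ?_⟩
  letI := IwasawaAlgebra.isDomain_quotient_X_pow_add_C p hm
  letI := IwasawaAlgebra.isDiscreteValuationRing_quotient_X_pow_add_C p hm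
  haveI := IwasawaAlgebra.EisensteinCoeff.isLocalRing_succ p hm
  letI := IwasawaAlgebra.EisensteinCoeff.algebraOfSpecSucc p m
  haveI := W.isScalarTower_algebraOfSpecSucc (K := K) (p := p) (m := m)
  letI := W.residueModuleSucc (K := K) (p := p) hm
  intro S hpS hbad hSN hSσ L hL hLS jbar' cd Dd fs hy hπ he hπX hek a ha
  haveI : IsTotallyComplex K := hyp.isImaginaryQuadratic.2
  have hN0 : N ≠ 0 := NeZero.ne N
  rw [WeierstrassCurve.selmerInfty, WeierstrassCurve.mem_selmerGroupOver_iff]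
  refine ⟨fun v σ ↦ ?_,
    fun w σ ↦ (W.baseChange K).mem_localKerOver_completion_of_isTotallyComplex p κ.kerSubgroup w _⟩
  -- (σ): the readout of `H¹_F(K, A_𝔮)` is `Γ_K`-stable
  have hobt1 := W.conjH1_mem_map_eisensteinTowerReadout_selmerA κ hm _ _ hy.killed hy.ker_red hπ he hπX hek
    hyp.topGenerator _ hy.cond_smul σ _ ⟨a, ha, rfl⟩
  obtain ⟨a', ha', ha'eq⟩ := hobt1
  rw [← ha'eq]
  -- a representative adapted to `v`, read through §1
  have hobt2 := DVRSetting.exists_of_eq_localization_mem _ hy hπ he ha' (Sum.inr v)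
  obtain ⟨k, c, rfl, hc⟩ := hobt2
  exact eisensteinTowerReadout_of_mem_localKerOver_of_mem_eisensteinSelmerStructure_ks W κ hm _ _ hy.killed hy.ker_red hπ
    he hπX hek hyp.isImaginaryQuadratic hyp.p_ne_two hyp.anticyclotomic hyp.heegner hN0 hyp.ordinary hKS hHp S hbad hSN v
    k c hc

/-! ## §2 (B5) -/

set_option maxHeartbeats 1600000 in
set_option synthInstance.maxHeartbeats 80000 in
/-- **(B5) at every class number** — the KS-letter `Stmt.readoutIndexKS` with the three idle binders deleted: the `m`-UNIFORM
index bound `#(Sel_{p^∞}(E/K_∞)[(conj_γ − 1)^m + p] ⧸ readout) ≤ p^c` for `m ≫ 0` and every admissible Eisenstein datum, from the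
three place-wise clauses at every class number (K2a). Proof verbatim `readoutIndexKS_of_localClauses`.
[cite: Howard2004HeegnerKolyvagin, Prop. 2.2.8 (second map) and proof of Thm. 2.2.10 (𝔮 = T^m + p)]
[cite: GreenbergLNM1716, Prop. 2.4, §3 Lemma 3.3 and §4 pp. 98, 104] [cite: MastellaZerman2026, Thm. 2.40] -/
theorem readoutIndexKS_anyClassNumber :
    Stmt.kummerStrictOnFrames →
    ∀ (N : ℕ) [NeZero N] (W : WeierstrassCurve ℚ) [W.IsGloballyMinimal] (K : Type) [Field K] [NumberField K]
      (p : ℕ) [Fact p.Prime] (κ : ZpExtension K p) (γ : Field.absoluteGaloisGroup K)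
      (jbar : AlgebraicClosure K →+* ℂ) (hyp : CastellaGrossiLeeSkinner2022.Thm413Hypotheses N W K p κ γ),
      W.HasIrreducibleModPGaloisRep p → (W.baseChange K).HasIrreducibleModPGaloisRep p →
      SatisfiesHeegnerHypothesis p K →
      ∃ c m₁ : ℕ, ∀ (m : ℕ) (hm : 1 ≤ m), m₁ ≤ m →
        haveI := hyp.isElliptic
        letI := IwasawaAlgebra.isDomain_quotient_X_pow_add_C p hm
        letI := IwasawaAlgebra.isDiscreteValuationRing_quotient_X_pow_add_C p hm
        haveI := IwasawaAlgebra.EisensteinCoeff.isLocalRing_succ p hm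
        letI := IwasawaAlgebra.EisensteinCoeff.algebraOfSpecSucc p m
        haveI := W.isScalarTower_algebraOfSpecSucc (K := K) (p := p) (m := m)
        letI := W.residueModuleSucc (K := K) (p := p) hm
        ∀ (S : Finset (IsDedekindDomain.HeightOneSpectrum (NumberField.RingOfIntegers K)))
          (hpS : ∀ v, ((p : ℕ) : NumberField.RingOfIntegers K) ∈ v.asIdeal → v ∈ S)
          (hbad : ∀ v, v ∉ S → ((p : ℕ) : NumberField.RingOfIntegers K) ∉ v.asIdeal →
            (W.baseChange K).HasGoodReductionAt v)
          (_hSN : ∀ v ∈ S, ((p : ℕ) : NumberField.RingOfIntegers K) ∈ v.asIdeal ∨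
            ((N : ℕ) : NumberField.RingOfIntegers K) ∈ v.asIdeal)
          (_hSσ : ∀ (σ : K ≃ₐ[ℚ] K) (v : IsDedekindDomain.HeightOneSpectrum (NumberField.RingOfIntegers K)),
            σ • v ∈ S → v ∈ S)
          (L : Set (IsDedekindDomain.HeightOneSpectrum (NumberField.RingOfIntegers K)))
          (hL : L ⊆ (W.eisensteinTower (κ.unitTwist (-1)) hm).degreeTwoPrimes p)
          (hLS : ∀ v ∈ L, v ∉ S) (jbar' : AlgebraicClosure K →+* ℂ) (cd : ConjugationDatum K)
          (Dd : ∀ k, DualityDatum p cd ((W.eisensteinTower (κ.unitTwist (-1)) hm).ρ k)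
            (IwasawaAlgebra.EisensteinCoeff p m (k + 1)))
          (fs : ∀ (k : ℕ) (n : Finset (IsDedekindDomain.HeightOneSpectrum (NumberField.RingOfIntegers K)))
            (v : IsDedekindDomain.HeightOneSpectrum (NumberField.RingOfIntegers K)),
            galoisCohomology ((W.eisensteinLevelQuot (κ.unitTwist (-1)) hm k n).toLocal (Sum.inr v)) 1 →+
              SingularQuotient (GaloisRep.toLocal v (W.eisensteinLevelQuot (κ.unitTwist (-1)) hm k n)) ⊗[ℤ]
                Gell v)
          (hy : (W.eisensteinDVRSetting (κ.unitTwist (-1)) hm S hpS hbad L hL hLS jbar' cd Dd fs).SatisfiesH)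
          (hπ : (W.eisensteinDVRSetting (κ.unitTwist (-1)) hm S hpS hbad L hL hLS jbar' cd Dd fs).π ∈ IsLocalRing.maximalIdeal (IwasawaAlgebra p ⧸ Ideal.span {(PowerSeries.X ^ m + PowerSeries.C (p : ℤ_[p]) : IwasawaAlgebra p)}))
          (he : ∀ k, (W.eisensteinDVRSetting (κ.unitTwist (-1)) hm S hpS hbad L hL hLS jbar' cd Dd fs).e k ≤ (W.eisensteinDVRSetting (κ.unitTwist (-1)) hm S hpS hbad L hL hLS jbar' cd Dd fs).e (k + 1))
          (hπX : (W.eisensteinDVRSetting (κ.unitTwist (-1)) hm S hpS hbad L hL hLS jbar' cd Dd fs).π =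
            Ideal.Quotient.mk (Ideal.span {(PowerSeries.X ^ m + PowerSeries.C (p : ℤ_[p]) : IwasawaAlgebra p)}) PowerSeries.X)
          (hek : ∀ k, (W.eisensteinDVRSetting (κ.unitTwist (-1)) hm S hpS hbad L hL hLS jbar' cd Dd fs).e (k + 1) - (W.eisensteinDVRSetting (κ.unitTwist (-1)) hm S hpS hbad L hL hLS jbar' cd Dd fs).e k = m),
          Finite (↥((((W.baseChange K).conjSelmerInfty κ γ - 1) ^ m + (p : AddMonoid.End ((W.baseChange K).selmerInfty κ))).ker) ⧸ ((((W.eisensteinDVRSetting (κ.unitTwist (-1)) hm S hpS hbad L hL hLS jbar' cd Dd fs).T.selmerA (W.eisensteinDVRSetting (κ.unitTwist (-1)) hm S hpS hbad L hL hLS jbar' cd Dd fs).π (W.eisensteinDVRSetting (κ.unitTwist (-1)) hm S hpS hbad L hL hLS jbar' cd Dd fs).e hy.killed hy.ker_red hπ he (fun k ↦ ((W.eisensteinDVRSetting (κ.unitTwist (-1)) hm S hpS hbad L hL hLS jbar' cd Dd fs).t k).cond)).map (W.eisensteinTowerReadout κ hm (W.eisensteinDVRSetting (κ.unitTwist (-1))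 hm S hpS hbad L hL hLS jbar' cd Dd fs).π (W.eisensteinDVRSetting (κ.unitTwist (-1)) hm S hpS hbad L hL hLS jbar' cd Dd fs).e hy.killed hy.ker_red hπ he hπX hek)).comap ((W.baseChange K).selmerInfty κ).subtype).addSubgroupOf ((((W.baseChange K).conjSelmerInfty κ γ - 1) ^ m + (p : AddMonoid.End ((W.baseChange K).selmerInfty κ))).ker)) ∧
            Nat.card (↥((((W.baseChange K).conjSelmerInfty κ γ - 1) ^ m + (p : AddMonoid.End ((W.baseChange K).selmerInfty κ))).ker) ⧸ ((((W.eisensteinDVRSetting (κ.unitTwist (-1)) hm S hpS hbad L hL hLS jbar' cd Dd fs).T.selmerA (W.eisensteinDVRSetting (κ.unitTwist (-1)) hm S hpS hbad L hL hLS jbar' cd Dd fs).π (W.eisensteinDVRSetting (κ.unitTwist (-1)) hm S hpS hbad L hL hLS jbar' cd Dd fs).e hy.killed hy.ker_red hπ he (fun k ↦ ((W.eisensteinDVRSetting (κ.unitTwist (-1)) hm S hpS hbad L hL hLS jbar' cd Dd fs).t k).cond)).map (W.eisensteinTowerReadout κ hm (W.eisensteinDVRSetting (κ.unitTwist (-1))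 hm S hpS hbad L hL hLS jbar' cd Dd fs).π (W.eisensteinDVRSetting (κ.unitTwist (-1)) hm S hpS hbad L hL hLS jbar' cd Dd fs).e hy.killed hy.ker_red hπ he hπX hek)).comap ((W.baseChange K).selmerInfty κ).subtype).addSubgroupOf ((((W.baseChange K).conjSelmerInfty κ γ - 1) ^ m + (p : AddMonoid.End ((W.baseChange K).selmerInfty κ))).ker)) ≤ p ^ c := by
  intro hKS N _ W _ K _ _ p _ κ γ jbar hyp hirr hirrK hHp
  haveI := hyp.isElliptic
  haveI : IsTotallyComplex K := hyp.isImaginaryQuadratic.isTotallyComplex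
  have hobt1 := readoutLocalOffKS_anyClassNumber hKS N W K p κ γ jbar hyp hirr hirrK hHp
  obtain ⟨m₁, hOff₁⟩ := hobt1
  have hobt2 := readoutLocalIndexPKS_anyClassNumber hKS N W K p κ γ jbar hyp hirr hirrK hHp
  obtain ⟨cP, m₂, hP₁⟩ := hobt2
  have hobt3 := readoutLocalIndexBadKS_anyClassNumber hKS N W K p κ γ jbar hyp hirr hirrK hHp
  obtain ⟨cB, m₃, hB₁⟩ := hobt3
  -- the admissible `S` are confined to the finitely many places above `pN`
  have hS₀ := finite_setOf_mem_or_mem (K := K) p N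
  refine ⟨(cP + cB) * hS₀.toFinset.card, m₁ + m₂ + m₃, fun m hm hmle ↦ ?_⟩
  letI := IwasawaAlgebra.isDomain_quotient_X_pow_add_C p hm
  letI := IwasawaAlgebra.isDiscreteValuationRing_quotient_X_pow_add_C p hm
  haveI := IwasawaAlgebra.EisensteinCoeff.isLocalRing_succ p hm
  letI := IwasawaAlgebra.EisensteinCoeff.algebraOfSpecSucc p m
  haveI := W.isScalarTower_algebraOfSpecSucc (K := K) (p := p) (m := m)
  letI := W.residueModuleSucc (K := K) (p := p) hm
  have hm₁ : m₁ ≤ m := by omega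
  have hm₂ : m₂ ≤ m := by omega
  have hm₃ : m₃ ≤ m := by omega
  have hppos : 0 < p := (Fact.out : p.Prime).pos
  intro S hpS hbad hSN hSσ L hL hLS jbar' cd Dd fs hy hπ he hπX hek
  have hScard : S.card ≤ hS₀.toFinset.card :=
    Finset.card_le_card fun v hv ↦ hS₀.mem_toFinset.mpr (hSN v hv)
  -- the three clauses at this `m` and datum
  have hobt4 := hOff₁ m hm hm₁ S hpS hbad hSN hSσ L hL hLS jbar' cd Dd fs hy hπ he hπX hek
  obtain ⟨j₁, hOff₂⟩ := hobt4
  have hobt5 := hP₁ m hm hm₂ S hpS hbad hSN hSσ L hL hLS jbar' cd Dd fs hy hπ he hπX hek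
  obtain ⟨j₂, hP₂⟩ := hobt5
  have hobt6 := hB₁ m hm hm₃ S hpS hbad hSN hSσ L hL hLS jbar' cd Dd fs hy hπ he hπX hek
  obtain ⟨j₃, hB₂⟩ := hobt6
  have hj₁ : ∀ j, j₁ + j₂ + j₃ ≤ j → j₁ ≤ j := fun j h ↦ by omega
  have hj₂ : ∀ j, j₁ + j₂ + j₃ ≤ j → j₂ ≤ j := fun j h ↦ by omega
  have hj₃ : ∀ j, j₁ + j₂ + j₃ ≤ j → j₃ ≤ j := fun j h ↦ by omega
  -- the relaxed local conditions, CHOSEN from the two index clauses at `v ∈ S` (`⊤` where nothing is asked)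
  have hex : ∀ (j : ℕ) (v : IsDedekindDomain.HeightOneSpectrum (NumberField.RingOfIntegers K)),
      ∃ Fv : AddSubgroup (galoisCohomology (((W.eisensteinDVRSetting (κ.unitTwist (-1)) hm S hpS hbad L hL hLS jbar' cd Dd fs).T.ρ j).toLocal (Sum.inr v)) 1),
        j₁ + j₂ + j₃ ≤ j → v ∈ S →
          (∀ c : galoisCohomology ((W.eisensteinDVRSetting (κ.unitTwist (-1)) hm S hpS hbad L hL hLS jbar' cd Dd fs).T.ρ j) 1,
            W.eisensteinTowerReadout κ hm (W.eisensteinDVRSetting (κ.unitTwist (-1)) hm S hpS hbad L hL hLS jbar' cd Dd fs).π (W.eisensteinDVRSetting (κ.unitTwist (-1)) hm S hpS hbad L hL hLS jbar' cd Dd fs).e hy.killed hy.ker_red hπ he hπX hek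
              (AddCommGroup.DirectLimit.of (fun k => galoisCohomology ((W.eisensteinDVRSetting (κ.unitTwist (-1)) hm S hpS hbad L hL hLS jbar' cd Dd fs).T.ρ k) 1)
                (AdicTower.incH1LE (W.eisensteinDVRSetting (κ.unitTwist (-1)) hm S hpS hbad L hL hLS jbar' cd Dd fs).T (W.eisensteinDVRSetting (κ.unitTwist (-1)) hm S hpS hbad L hL hLS jbar' cd Dd fs).π (W.eisensteinDVRSetting (κ.unitTwist (-1)) hm S hpS hbad L hL hLS jbar' cd Dd fs).e hy.killed hy.ker_red hπ he) j c) ∈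
            (W.baseChange K).selmerInfty κ →
            galoisCohomology.localization ((W.eisensteinDVRSetting (κ.unitTwist (-1)) hm S hpS hbad L hL hLS jbar' cd Dd fs).T.ρ j) (Sum.inr v) 1 c ∈ Fv) ∧
          Finite (↥Fv ⧸ (AdicTower.condA (W.eisensteinDVRSetting (κ.unitTwist (-1)) hm S hpS hbad L hL hLS jbar' cd Dd fs).T (W.eisensteinDVRSetting (κ.unitTwist (-1)) hm S hpS hbad L hL hLS jbar' cd Dd fs).π (W.eisensteinDVRSetting (κ.unitTwist (-1)) hm S hpS hbad L hL hLS jbar' cd Dd fs).e hy.killed hy.ker_red hπ he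
                (fun k => ((W.eisensteinDVRSetting (κ.unitTwist (-1)) hm S hpS hbad L hL hLS jbar' cd Dd fs).t k).cond) j (Sum.inr v)).addSubgroupOf Fv) ∧
          Nat.card (↥Fv ⧸ (AdicTower.condA (W.eisensteinDVRSetting (κ.unitTwist (-1)) hm S hpS hbad L hL hLS jbar' cd Dd fs).T (W.eisensteinDVRSetting (κ.unitTwist (-1)) hm S hpS hbad L hL hLS jbar' cd Dd fs).π (W.eisensteinDVRSetting (κ.unitTwist (-1)) hm S hpS hbad L hL hLS jbar' cd Dd fs).e hy.killed hy.ker_red hπ he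
                (fun k => ((W.eisensteinDVRSetting (κ.unitTwist (-1)) hm S hpS hbad L hL hLS jbar' cd Dd fs).t k).cond) j (Sum.inr v)).addSubgroupOf Fv) ≤ p ^ (cP + cB) := by
    intro j v
    by_cases hj : j₁ + j₂ + j₃ ≤ j
    · by_cases hv : v ∈ S
      · by_cases hp : ((p : ℕ) : NumberField.RingOfIntegers K) ∈ v.asIdeal
        · obtain ⟨Fv, h1, h2, h3⟩ := hP₂ j (hj₂ j hj) v hv hp
          exact ⟨Fv, fun _ _ ↦ ⟨h1, h2, h3.trans (Nat.pow_le_pow_right hppos (Nat.le_add_right _ _))⟩⟩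
        · obtain ⟨Fv, h1, h2, h3⟩ := hB₂ j (hj₃ j hj) v hv hp
          exact ⟨Fv, fun _ _ ↦ ⟨h1, h2, h3.trans (Nat.pow_le_pow_right hppos (Nat.le_add_left _ _))⟩⟩
      · exact ⟨⊤, fun _ h ↦ (hv h).elim⟩
    · exact ⟨⊤, fun h _ ↦ (hj h).elim⟩
  let F' : ∀ j, SelmerStructure ((W.eisensteinDVRSetting (κ.unitTwist (-1)) hm S hpS hbad L hL hLS jbar' cd Dd fs).T.ρ j) := fun j v ↦
    match v with
    | Sum.inl _ => ⊤
    | Sum.inr v => Classical.choose (hex j v)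
  -- (hS') the relaxed conditions contain the local classes
  have hS' : ∀ j, j₁ + j₂ + j₃ ≤ j → ∀ c : galoisCohomology ((W.eisensteinDVRSetting (κ.unitTwist (-1)) hm S hpS hbad L hL hLS jbar' cd Dd fs).T.ρ j) 1,
      W.eisensteinTowerReadout κ hm (W.eisensteinDVRSetting (κ.unitTwist (-1)) hm S hpS hbad L hL hLS jbar' cd Dd fs).π (W.eisensteinDVRSetting (κ.unitTwist (-1)) hm S hpS hbad L hL hLS jbar' cd Dd fs).e hy.killed hy.ker_red hπ he hπX hek
              (AddCommGroup.DirectLimit.of (fun k => galoisCohomology ((W.eisensteinDVRSetting (κ.unitTwist (-1)) hm S hpS hbad L hL hLS jbar' cd Dd fs).T.ρ k) 1)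
                (AdicTower.incH1LE (W.eisensteinDVRSetting (κ.unitTwist (-1)) hm S hpS hbad L hL hLS jbar' cd Dd fs).T (W.eisensteinDVRSetting (κ.unitTwist (-1)) hm S hpS hbad L hL hLS jbar' cd Dd fs).π (W.eisensteinDVRSetting (κ.unitTwist (-1)) hm S hpS hbad L hL hLS jbar' cd Dd fs).e hy.killed hy.ker_red hπ he) j c) ∈
            (W.baseChange K).selmerInfty κ →
      ∀ v ∈ S, galoisCohomology.localization ((W.eisensteinDVRSetting (κ.unitTwist (-1)) hm S hpS hbad L hL hLS jbar' cd Dd fs).T.ρ j) (Sum.inr v) 1 c ∈ F' j (Sum.inr v) :=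
    fun j hj c hc v hv ↦ ((Classical.choose_spec (hex j v)) hj hv).1 c hc
  -- (hoff) outside `S`: Howard's condition itself
  have hoff' : ∀ j, j₁ + j₂ + j₃ ≤ j → ∀ c : galoisCohomology ((W.eisensteinDVRSetting (κ.unitTwist (-1)) hm S hpS hbad L hL hLS jbar' cd Dd fs).T.ρ j) 1,
      W.eisensteinTowerReadout κ hm (W.eisensteinDVRSetting (κ.unitTwist (-1)) hm S hpS hbad L hL hLS jbar' cd Dd fs).π (W.eisensteinDVRSetting (κ.unitTwist (-1)) hm S hpS hbad L hL hLS jbar' cd Dd fs).e hy.killed hy.ker_red hπ he hπX hek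
              (AddCommGroup.DirectLimit.of (fun k => galoisCohomology ((W.eisensteinDVRSetting (κ.unitTwist (-1)) hm S hpS hbad L hL hLS jbar' cd Dd fs).T.ρ k) 1)
                (AdicTower.incH1LE (W.eisensteinDVRSetting (κ.unitTwist (-1)) hm S hpS hbad L hL hLS jbar' cd Dd fs).T (W.eisensteinDVRSetting (κ.unitTwist (-1)) hm S hpS hbad L hL hLS jbar' cd Dd fs).π (W.eisensteinDVRSetting (κ.unitTwist (-1)) hm S hpS hbad L hL hLS jbar' cd Dd fs).e hy.killed hy.ker_red hπ he) j c) ∈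
            (W.baseChange K).selmerInfty κ →
      ∀ v ∉ S, galoisCohomology.localization ((W.eisensteinDVRSetting (κ.unitTwist (-1)) hm S hpS hbad L hL hLS jbar' cd Dd fs).T.ρ j) (Sum.inr v) 1 c ∈
        AdicTower.condA (W.eisensteinDVRSetting (κ.unitTwist (-1)) hm S hpS hbad L hL hLS jbar' cd Dd fs).T (W.eisensteinDVRSetting (κ.unitTwist (-1)) hm S hpS hbad L hL hLS jbar' cd Dd fs).π (W.eisensteinDVRSetting (κ.unitTwist (-1)) hm S hpS hbad L hL hLS jbar' cd Dd fs).e hy.killed hy.ker_red hπ he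
                (fun k => ((W.eisensteinDVRSetting (κ.unitTwist (-1)) hm S hpS hbad L hL hLS jbar' cd Dd fs).t k).cond) j (Sum.inr v) :=
    fun j hj c hc v hv ↦ hOff₂ j (hj₁ j hj) c hc v hv
  -- (hinf) the infinite places are complex
  have hinf' : ∀ j, j₁ + j₂ + j₃ ≤ j → ∀ c : galoisCohomology ((W.eisensteinDVRSetting (κ.unitTwist (-1)) hm S hpS hbad L hL hLS jbar' cd Dd fs).T.ρ j) 1,
      W.eisensteinTowerReadout κ hm (W.eisensteinDVRSetting (κ.unitTwist (-1)) hm S hpS hbad L hL hLS jbar' cd Dd fs).π (W.eisensteinDVRSetting (κ.unitTwist (-1)) hm S hpS hbad L hL hLS jbar' cd Dd fs).e hy.killed hy.ker_red hπ he hπX hek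
              (AddCommGroup.DirectLimit.of (fun k => galoisCohomology ((W.eisensteinDVRSetting (κ.unitTwist (-1)) hm S hpS hbad L hL hLS jbar' cd Dd fs).T.ρ k) 1)
                (AdicTower.incH1LE (W.eisensteinDVRSetting (κ.unitTwist (-1)) hm S hpS hbad L hL hLS jbar' cd Dd fs).T (W.eisensteinDVRSetting (κ.unitTwist (-1)) hm S hpS hbad L hL hLS jbar' cd Dd fs).π (W.eisensteinDVRSetting (κ.unitTwist (-1)) hm S hpS hbad L hL hLS jbar' cd Dd fs).e hy.killed hy.ker_red hπ he) j c) ∈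
            (W.baseChange K).selmerInfty κ →
      ∀ w : InfinitePlace K, galoisCohomology.localization ((W.eisensteinDVRSetting (κ.unitTwist (-1)) hm S hpS hbad L hL hLS jbar' cd Dd fs).T.ρ j) (Sum.inl w) 1 c ∈
        AdicTower.condA (W.eisensteinDVRSetting (κ.unitTwist (-1)) hm S hpS hbad L hL hLS jbar' cd Dd fs).T (W.eisensteinDVRSetting (κ.unitTwist (-1)) hm S hpS hbad L hL hLS jbar' cd Dd fs).π (W.eisensteinDVRSetting (κ.unitTwist (-1)) hm S hpS hbad L hL hLS jbar' cd Dd fs).e hy.killed hy.ker_red hπ he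
                (fun k => ((W.eisensteinDVRSetting (κ.unitTwist (-1)) hm S hpS hbad L hL hLS jbar' cd Dd fs).t k).cond) j (Sum.inl w) := by
    intro j _ c _ w
    have h0 := galoisCohomology_one_toLocal_inl_eq_zero_of_isComplex ((W.eisensteinDVRSetting (κ.unitTwist (-1)) hm S hpS hbad L hL hLS jbar' cd Dd fs).T.ρ j)
      (IsTotallyComplex.isComplex w) (galoisCohomology.localization ((W.eisensteinDVRSetting (κ.unitTwist (-1)) hm S hpS hbad L hL hLS jbar' cd Dd fs).T.ρ j) (Sum.inl w) 1 c)
    rw [h0]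
    exact zero_mem _
  -- (hfin)
  have hfin' : ∀ j, j₁ + j₂ + j₃ ≤ j → ∀ v ∈ S, Finite (↥(F' j (Sum.inr v)) ⧸
      (AdicTower.condA (W.eisensteinDVRSetting (κ.unitTwist (-1)) hm S hpS hbad L hL hLS jbar' cd Dd fs).T (W.eisensteinDVRSetting (κ.unitTwist (-1)) hm S hpS hbad L hL hLS jbar' cd Dd fs).π (W.eisensteinDVRSetting (κ.unitTwist (-1)) hm S hpS hbad L hL hLS jbar' cd Dd fs).e hy.killed hy.ker_red hπ he
                (fun k => ((W.eisensteinDVRSetting (κ.unitTwist (-1)) hm S hpS hbad L hL hLS jbar' cd Dd fs).t k).cond) j (Sum.inr v)).addSubgroupOf (F' j (Sum.inr v))) :=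
    fun j hj v hv ↦ ((Classical.choose_spec (hex j v)) hj hv).2.1
  -- (hC) `∏_{v ∈ S} ≤ (p^(cP+cB))^#S ≤ p^((cP+cB) #S₀)`
  have hC' : ∀ j, j₁ + j₂ + j₃ ≤ j → ∏ v ∈ S, Nat.card (↥(F' j (Sum.inr v)) ⧸
      (AdicTower.condA (W.eisensteinDVRSetting (κ.unitTwist (-1)) hm S hpS hbad L hL hLS jbar' cd Dd fs).T (W.eisensteinDVRSetting (κ.unitTwist (-1)) hm S hpS hbad L hL hLS jbar' cd Dd fs).π (W.eisensteinDVRSetting (κ.unitTwist (-1)) hm S hpS hbad L hL hLS jbar' cd Dd fs).e hy.killed hy.ker_red hπ he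
                (fun k => ((W.eisensteinDVRSetting (κ.unitTwist (-1)) hm S hpS hbad L hL hLS jbar' cd Dd fs).t k).cond) j (Sum.inr v)).addSubgroupOf (F' j (Sum.inr v))) ≤ p ^ ((cP + cB) * hS₀.toFinset.card) := by
    intro j hj
    refine (Finset.prod_le_pow_card S _ (p ^ (cP + cB))
      (fun v hv ↦ ((Classical.choose_spec (hex j v)) hj hv).2.2)).trans ?_
    rw [← pow_mul]
    exact Nat.pow_le_pow_right hppos (Nat.mul_le_mul_left _ hScard)
  exact W.finite_and_natCard_kerPsi_quotient_eisensteinTowerReadout_le_of_local κ hm hyp.topGenerator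
    hyp.noPTorsion S hpS hbad L hL hLS jbar' cd Dd fs hy hπ he hπX hek S F' (j₁ + j₂ + j₃)
    (p ^ ((cP + cB) * hS₀.toFinset.card)) hS' hoff' hinf' hfin' hC'

end Summit.BirchSwinnertonDyer.BirchSwinnertonDyer.Theorems.HeegnerMuPartControlGlue

end
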